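import Mathlib.AlgebraicGeometry.EllipticCurve.Affine.Point
import Mathlib.RingTheory.Localization.Away.Basic
import HarnessLib

/-!
# The chart at `O` of a Weierstrass cubic: Silverman's `(z, w)`-coordinates

Let `W` be a Weierstrass equation over a commutative ring `R`, with plane cubic
`E : Y²Z + a₁XYZ + a₃YZ² = X³ + a₂X²Z + a₄XZ² + a₆Z³ ⊂ ℙ²_R` and `O = [0 : 1 : 0]`. The cubic is
covered by the two standard affine charts `Z ≠ 0` and `Y ≠ 0` (a point with `Y = Z = 0` would
have `X³ = 0`). The first is Mathlib's affine curve with coordinate ring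
`R[W] = R[X, Y]/(W(X, Y))` (`WeierstrassCurve.Affine.CoordinateRing`). The second is the chart
at `O` of Silverman, *The Arithmetic of Elliptic Curves*, IV.1: in the coordinates
`z = -X/Y`, `w = -Z/Y` (so `z = -x/y`, `w = -1/y` on the overlap) the cubic becomes
`w = z³ + a₁zw + a₂z²w + a₃w² + a₄zw² + a₆w³` (AEC IV.1, first display) and `O` is the origin
`(z, w) = (0, 0)`. This file sets up that chart as commutative algebra, to be glued to Mathlib's
affine chart along `{y ≠ 0} = {w ≠ 0}` when the cubic is assembled as a scheme:

* `WeierstrassCurve.zwPolynomial W : R[X][Y]` — the chart equation as a bivariate polynomial,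
  *monic cubic in the outer variable* `z` over `R[w]` (inner variable `X ↔ w`, outer `Y ↔ z`):
  `z³ + a₂w·z² + (a₁w + a₄w²)·z + (a₃w² + a₆w³ - w)`; `evalEval_zwPolynomial`,
  `WeierstrassCurve.ZWEquation`, `map_zwPolynomial`, `monic_zwPolynomial`,
  `natDegree_zwPolynomial`.
* `WeierstrassCurve.ZWCoordinateRing W = R[w][z]/(zwPolynomial)` (an `AdjoinRoot`, like
  Mathlib's `CoordinateRing`), its generators `zClass`, `wClass`, the relation `zw_relation`,
  and the facts that it is free of rank `3` and finite over `R[w]` (`Module.Free`,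
  `Module.Finite`, from `AdjoinRoot.powerBasis'`).
* The transition maps of the two charts (AEC IV.1: `z = -x/y`, `w = -1/y`, inversely
  `x = z/w`, `y = -1/w`): `toZWAway : R[W] →+* R[W]_O[1/w]` and
  `zwToAway : R[W]_O →+* R[W][1/y]`, their extensions to the localisations, and the ring
  isomorphism `awayEquiv : R[W][1/y] ≃+* R[W]_O[1/w]` they induce (`awayEquiv_algebraMap_…`
  compute it on generators; `awayEquiv_algebraMap_base` records `R`-linearity).

Everything is over an arbitrary commutative ring `R` and is functorial in `W`; no smoothness is
assumed (the chart exists for every Weierstrass equation).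

## References

* [SilvermanAEC2009] J. H. Silverman, *The Arithmetic of Elliptic Curves*, 2nd ed., GTM 106,
  Springer 2009, IV.1 (the change of variables `z = -x/y`, `w = -1/y` and the equation
  `w = z³ + a₁zw + a₂z²w + a₃w² + a₄zw² + a₆w³`), III.1 (the Weierstrass cubic in `ℙ²`).

## Design

* Declarations are deliberate dot-notation extensions in `namespace WeierstrassCurve`, as in the
  other elliptic-curve preludes of this directory (`Isogeny`, `AbelianVarietyBridge`).
* The bivariate convention is Mathlib's (`R[X][Y]`, inner variable first in `evalEval`): since
  the chart equation is monic in `z` but not in `w`, the *inner* variable is `w` and the *outer*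
  one is `z`, so `W.zwPolynomial.evalEval w z` is the value at the point `(z, w)`; the predicate
  `W.ZWEquation z w` restores the natural order of arguments.
* The localisations are the concrete `Localization.Away`; the transition maps are built with
  `AdjoinRoot.lift` and `IsLocalization.Away.lift`, and the two polynomial identities behind
  them (`W(z/w, -1/w) = -w⁻³·G(z, w)`, `G(-x/y, -1/y) = y⁻³·W(x, y)`) are discharged by
  `linear_combination` with explicit cofactors.
-/

noncomputable section

open Polynomial
open scoped Polynomial.Bivariate

universe u v

namespace WeierstrassCurve

variable {R : Type u} [CommRing R] (W : WeierstrassCurve R)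

/-! ## The chart equation -/

/-- The equation of a Weierstrass cubic in the chart `Y ≠ 0` at `O = [0:1:0]`, in Silverman's
coordinates `z = -X/Y`, `w = -Z/Y` (AEC IV.1): the bivariate polynomial
`G(z, w) = z³ + a₂w·z² + (a₁w + a₄w²)·z + (a₃w² + a₆w³ - w)`, i.e.
`z³ + a₁zw + a₂z²w + a₃w² + a₄zw² + a₆w³ - w`, written as a *monic cubic in the outer
variable* `Y ↔ z` with coefficients in `R[X]`, `X ↔ w`.
[cite: SilvermanAEC2009, IV.1] -/
def zwPolynomial : R[X][Y] :=
  Y ^ 3 + C (C W.a₂ * X) * Y ^ 2 + C (C W.a₁ * X + C W.a₄ * X ^ 2) * Y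
    + C (C W.a₃ * X ^ 2 + C W.a₆ * X ^ 3 - X)

/-- The value of the chart equation at `(z, w)` (inner variable `w` first, as in Mathlib's
`evalEval`): `G(z, w) = z³ + a₁zw + a₂z²w + a₃w² + a₄zw² + a₆w³ - w` (AEC IV.1).
[cite: SilvermanAEC2009, IV.1] -/
theorem evalEval_zwPolynomial (w z : R) : W.zwPolynomial.evalEval w z =
    z ^ 3 + W.a₁ * z * w + W.a₂ * z ^ 2 * w + W.a₃ * w ^ 2 + W.a₄ * z * w ^ 2
      + W.a₆ * w ^ 3 - w := by
  simp only [zwPolynomial, evalEval, eval_C, eval_X, eval_add, eval_sub, eval_mul, eval_pow]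
  ring

/-- The proposition that `(z, w)` lies on the Weierstrass cubic in the chart at `O`:
`w = z³ + a₁zw + a₂z²w + a₃w² + a₄zw² + a₆w³` (AEC IV.1). [cite: SilvermanAEC2009, IV.1] -/
def ZWEquation (z w : R) : Prop :=
  W.zwPolynomial.evalEval w z = 0

/-- Unfolding `ZWEquation`. [cite: SilvermanAEC2009, IV.1] -/
theorem zwEquation_iff (z w : R) : W.ZWEquation z w ↔
    z ^ 3 + W.a₁ * z * w + W.a₂ * z ^ 2 * w + W.a₃ * w ^ 2 + W.a₄ * z * w ^ 2
      + W.a₆ * w ^ 3 - w = 0 := by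
  rw [ZWEquation, evalEval_zwPolynomial]

/-- `O = (0, 0)` lies on the chart at `O` (AEC IV.1: "`O` is now the point `(z, w) = (0, 0)`").
[cite: SilvermanAEC2009, IV.1] -/
theorem zwEquation_zero : W.ZWEquation 0 0 := by
  rw [zwEquation_iff]
  ring

/-- The chart equation as a `Cubic` in `z` over `R[w]`. [folklore] -/
theorem zwPolynomial_eq : W.zwPolynomial = Cubic.toPoly
    ⟨1, C W.a₂ * X, C W.a₁ * X + C W.a₄ * X ^ 2, C W.a₃ * X ^ 2 + C W.a₆ * X ^ 3 - X⟩ := by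
  simp only [zwPolynomial, Cubic.toPoly, C_1, one_mul]

/-- The chart equation is monic (of degree `3`) in `z`. [folklore] -/
theorem monic_zwPolynomial : W.zwPolynomial.Monic := by
  rw [zwPolynomial_eq]
  exact Cubic.monic_of_a_eq_one rfl

/-- The chart equation has degree `3` in `z`. [folklore] -/
theorem natDegree_zwPolynomial [Nontrivial R] : W.zwPolynomial.natDegree = 3 := by
  rw [zwPolynomial_eq]
  exact Cubic.natDegree_of_a_ne_zero one_ne_zero

/-- The chart equation is compatible with change of coefficient ring. [folklore] -/
theorem map_zwPolynomial {S : Type v} [CommRing S] (φ : R →+* S) :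
    (W.map φ).zwPolynomial = W.zwPolynomial.map (mapRingHom φ) := by
  simp only [zwPolynomial, map_a₁, map_a₂, map_a₃, map_a₄, map_a₆, Polynomial.map_add,
    Polynomial.map_sub, Polynomial.map_mul, Polynomial.map_pow, map_C, map_X, coe_mapRingHom]

/-- The chart equation over an `R`-algebra `S` evaluates through `algebraMap R S`. [folklore] -/
theorem zwEquation_map_iff {S : Type v} [CommRing S] (φ : R →+* S) (z w : S) :
    (W.map φ).ZWEquation z w ↔
      z ^ 3 + φ W.a₁ * z * w + φ W.a₂ * z ^ 2 * w + φ W.a₃ * w ^ 2 + φ W.a₄ * z * w ^ 2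
        + φ W.a₆ * w ^ 3 - w = 0 := by
  rw [zwEquation_iff]
  rfl

/-! ## The coordinate ring of the chart at `O` -/

/-- The coordinate ring `R[W]_O = R[w][z]/(G(z, w))` of the chart `Y ≠ 0` of the Weierstrass
cubic (AEC IV.1), as an `AdjoinRoot` over `R[w]` (so that it is visibly free of rank `3` over
`R[w]`, the chart equation being a monic cubic in `z`). [cite: SilvermanAEC2009, IV.1] -/
abbrev ZWCoordinateRing : Type u :=
  AdjoinRoot W.zwPolynomial

namespace ZWCoordinateRing

/-- The quotient map `R[w][z] → R[W]_O`. [folklore] -/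
abbrev mk : R[X][Y] →+* W.ZWCoordinateRing :=
  AdjoinRoot.mk W.zwPolynomial

/-- The coordinate function `z = -X/Y` on the chart at `O` (class of the outer variable).
[cite: SilvermanAEC2009, IV.1] -/
def zClass : W.ZWCoordinateRing :=
  mk W Y

/-- The coordinate function `w = -Z/Y` on the chart at `O` (class of the inner variable).
[cite: SilvermanAEC2009, IV.1] -/
def wClass : W.ZWCoordinateRing :=
  mk W (C X)

/-- The class of the outer variable is `z`. [folklore] -/
theorem mk_Y : mk W Y = zClass W := rfl

/-- The class of the inner variable is `w`. [folklore] -/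
theorem mk_C_X : mk W (C X) = wClass W := rfl

/-- `zClass` is the adjoined root. [folklore] -/
theorem zClass_eq_root : zClass W = AdjoinRoot.root W.zwPolynomial := rfl

/-- `wClass` is the image of the base variable. [folklore] -/
theorem wClass_eq_of : wClass W = AdjoinRoot.of W.zwPolynomial X := rfl

/-- The chart equation holds in the coordinate ring:
`z³ + a₁zw + a₂z²w + a₃w² + a₄zw² + a₆w³ - w = 0` in `R[W]_O` (AEC IV.1).
[cite: SilvermanAEC2009, IV.1] -/
theorem zw_relation :
    zClass W ^ 3 + algebraMap R _ W.a₁ * zClass W * wClass W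
      + algebraMap R _ W.a₂ * zClass W ^ 2 * wClass W + algebraMap R _ W.a₃ * wClass W ^ 2
      + algebraMap R _ W.a₄ * zClass W * wClass W ^ 2 + algebraMap R _ W.a₆ * wClass W ^ 3
      - wClass W = 0 := by
  have h : mk W W.zwPolynomial = 0 := AdjoinRoot.mk_self
  have ha : ∀ a : R, algebraMap R W.ZWCoordinateRing a = mk W (C (C a)) := fun a ↦ rfl
  simp only [ha, zClass, wClass]
  simp only [zwPolynomial, map_add, map_sub, map_mul, map_pow] at h
  linear_combination h

/-- `R[W]_O` is a free `R[w]`-module (of rank `3`: basis `1, z, z²`), the chart equation being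
monic in `z`. [folklore] -/
instance : Module.Free R[X] W.ZWCoordinateRing :=
  .of_basis (AdjoinRoot.powerBasis' W.monic_zwPolynomial).basis

/-- `R[W]_O` is a finite `R[w]`-module. [folklore] -/
instance : Module.Finite R[X] W.ZWCoordinateRing :=
  .of_basis (AdjoinRoot.powerBasis' W.monic_zwPolynomial).basis

/-- The rank of `R[W]_O` over `R[w]` is `3` (for `R` nontrivial). [folklore] -/
theorem finrank_eq [Nontrivial R] : Module.finrank R[X] W.ZWCoordinateRing = 3 := by
  rw [Module.finrank_eq_card_basis (AdjoinRoot.powerBasis' W.monic_zwPolynomial).basis,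
    Fintype.card_fin]
  exact W.natDegree_zwPolynomial

end ZWCoordinateRing

/-! ## The transition maps between the two charts -/

section Transition

open ZWCoordinateRing IsLocalization

/-- Notation-free name for the class of `y` in Mathlib's affine coordinate ring `R[W]`. [folklore] -/
abbrev yClass : W.toAffine.CoordinateRing :=
  Affine.CoordinateRing.mk W.toAffine Y

/-- Notation-free name for the class of `x` in Mathlib's affine coordinate ring `R[W]`. [folklore] -/
abbrev xClass : W.toAffine.CoordinateRing :=
  Affine.CoordinateRing.mk W.toAffine (C X)

/-- The Weierstrass relation in `R[W]`:
`y² + a₁xy + a₃y - (x³ + a₂x² + a₄x + a₆) = 0`. [folklore] -/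
theorem xy_relation :
    yClass W ^ 2 + algebraMap R _ W.a₁ * xClass W * yClass W + algebraMap R _ W.a₃ * yClass W
      - (xClass W ^ 3 + algebraMap R _ W.a₂ * xClass W ^ 2 + algebraMap R _ W.a₄ * xClass W
        + algebraMap R _ W.a₆) = 0 := by
  have h : Affine.CoordinateRing.mk W.toAffine W.toAffine.polynomial = 0 := AdjoinRoot.mk_self
  have ha : ∀ a : R, algebraMap R W.toAffine.CoordinateRing a =
      Affine.CoordinateRing.mk W.toAffine (C (C a)) := fun a ↦ rfl
  simp only [ha, xClass, yClass]
  simp only [Affine.polynomial, map_add, map_sub, map_mul, map_pow] at h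
  linear_combination h

/-- The localisation `R[W][1/y]` (functions on the open `y ≠ 0` of the affine chart). [folklore] -/
abbrev AwayY : Type u := Localization.Away (yClass W)

/-- The localisation `R[W]_O[1/w]` (functions on the open `w ≠ 0` of the chart at `O`). [folklore] -/
abbrev AwayW : Type u := Localization.Away (wClass W)

/-- `R[W] → R[W]_O[1/w]`, `x ↦ z/w = -z · (-1/w)⁻¹…`, precisely `x ↦ z · w⁻¹`, `y ↦ -w⁻¹`
(AEC IV.1: `x = z/w`, `y = -1/w`). [cite: SilvermanAEC2009, IV.1] -/
def toZWAway : W.toAffine.CoordinateRing →+* W.AwayW :=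
  AdjoinRoot.lift
    (eval₂RingHom (algebraMap R W.AwayW)
      (algebraMap _ W.AwayW (zClass W) * Away.invSelf (wClass W)))
    (-Away.invSelf (wClass W)) <| by
    have hinv : algebraMap _ W.AwayW (wClass W) * Away.invSelf (wClass W) = 1 :=
      Away.mul_invSelf (wClass W)
    have hG := congrArg (algebraMap W.ZWCoordinateRing W.AwayW) (zw_relation W)
    simp only [map_add, map_sub, map_mul, map_pow, map_zero,
      ← IsScalarTower.algebraMap_apply] at hG
    simp only [Affine.polynomial, eval₂_add, eval₂_sub, eval₂_mul, eval₂_pow, eval₂_C, eval₂_X,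
      coe_eval₂RingHom]
    set zL : W.AwayW := algebraMap _ W.AwayW (zClass W)
    set wL : W.AwayW := algebraMap _ W.AwayW (wClass W)
    set wi : W.AwayW := Away.invSelf (wClass W)
    linear_combination (-wi ^ 3) * hG
      + (-(wi ^ 2 * (1 - algebraMap R W.AwayW W.a₁ * zL - algebraMap R W.AwayW W.a₂ * zL ^ 2)
          - wi * (algebraMap R W.AwayW W.a₃ + algebraMap R W.AwayW W.a₄ * zL) * (1 + wL * wi)
          - algebraMap R W.AwayW W.a₆ * (1 + wL * wi + wL ^ 2 * wi ^ 2))) * hinv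

/-- `R[W]_O → R[W][1/y]`, `z ↦ -x · y⁻¹`, `w ↦ -y⁻¹` (AEC IV.1: `z = -x/y`, `w = -1/y`).
[cite: SilvermanAEC2009, IV.1] -/
def zwToAway : W.ZWCoordinateRing →+* W.AwayY :=
  AdjoinRoot.lift
    (eval₂RingHom (algebraMap R W.AwayY) (-Away.invSelf (yClass W)))
    (-(algebraMap _ W.AwayY (xClass W) * Away.invSelf (yClass W))) <| by
    have hinv : algebraMap _ W.AwayY (yClass W) * Away.invSelf (yClass W) = 1 :=
      Away.mul_invSelf (yClass W)
    have hF := congrArg (algebraMap W.toAffine.CoordinateRing W.AwayY) (xy_relation W)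
    simp only [map_add, map_sub, map_mul, map_pow, map_zero,
      ← IsScalarTower.algebraMap_apply] at hF
    simp only [zwPolynomial, eval₂_add, eval₂_sub, eval₂_mul, eval₂_pow, eval₂_C, eval₂_X,
      coe_eval₂RingHom]
    set xL : W.AwayY := algebraMap _ W.AwayY (xClass W)
    set yL : W.AwayY := algebraMap _ W.AwayY (yClass W)
    set yi : W.AwayY := Away.invSelf (yClass W)
    linear_combination yi ^ 3 * hF
      - (yi ^ 2 * (algebraMap R W.AwayY W.a₁ * xL + algebraMap R W.AwayY W.a₃) + yi
          + yL * yi ^ 2) * hinv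

/-! ### Values on generators -/

/-- `x ↦ z · w⁻¹`. [cite: SilvermanAEC2009, IV.1] -/
@[simp]
theorem toZWAway_xClass : W.toZWAway (xClass W) =
    algebraMap _ W.AwayW (zClass W) * Away.invSelf (wClass W) := by
  rw [xClass, toZWAway, AdjoinRoot.lift_mk, eval₂_C, coe_eval₂RingHom, eval₂_X]

/-- `y ↦ -w⁻¹`. [cite: SilvermanAEC2009, IV.1] -/
@[simp]
theorem toZWAway_yClass : W.toZWAway (yClass W) = -Away.invSelf (wClass W) := by
  rw [yClass, toZWAway, AdjoinRoot.lift_mk, eval₂_X]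

/-- `toZWAway` is `R`-linear. [folklore] -/
@[simp]
theorem toZWAway_algebraMap (r : R) :
    W.toZWAway (algebraMap R _ r) = algebraMap R W.AwayW r := by
  rw [IsScalarTower.algebraMap_apply R R[X] W.toAffine.CoordinateRing, AdjoinRoot.algebraMap_eq,
    toZWAway, AdjoinRoot.lift_of, Polynomial.algebraMap_apply, coe_eval₂RingHom, eval₂_C,
    Algebra.algebraMap_self_apply]

/-- `z ↦ -x · y⁻¹`. [cite: SilvermanAEC2009, IV.1] -/
@[simp]
theorem zwToAway_zClass : W.zwToAway (zClass W) =
    -(algebraMap _ W.AwayY (xClass W) * Away.invSelf (yClass W)) := by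
  rw [zClass, zwToAway, AdjoinRoot.lift_mk, eval₂_X]

/-- `w ↦ -y⁻¹`. [cite: SilvermanAEC2009, IV.1] -/
@[simp]
theorem zwToAway_wClass : W.zwToAway (wClass W) = -Away.invSelf (yClass W) := by
  rw [wClass, zwToAway, AdjoinRoot.lift_mk, eval₂_C, coe_eval₂RingHom, eval₂_X]

/-- `zwToAway` is `R`-linear. [folklore] -/
@[simp]
theorem zwToAway_algebraMap (r : R) :
    W.zwToAway (algebraMap R _ r) = algebraMap R W.AwayY r := by
  rw [IsScalarTower.algebraMap_apply R R[X] W.ZWCoordinateRing, AdjoinRoot.algebraMap_eq,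
    zwToAway, AdjoinRoot.lift_of, Polynomial.algebraMap_apply, coe_eval₂RingHom, eval₂_C,
    Algebra.algebraMap_self_apply]

/-- In a commutative monoid, two right inverses of the same element agree. [folklore] -/
private theorem inv_unique {M : Type*} [CommMonoid M] {a s t : M} (hs : a * s = 1)
    (ht : a * t = 1) : s = t :=
  left_inv_eq_right_inv (by rwa [mul_comm] at hs) ht

/-- `y ↦ -w⁻¹` is a unit of `R[W]_O[1/w]`. [folklore] -/
theorem isUnit_toZWAway_yClass : IsUnit (W.toZWAway (yClass W)) := by
  rw [toZWAway_yClass, IsUnit.neg_iff]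
  exact IsUnit.of_mul_eq_one_right _ (Away.mul_invSelf (wClass W))

/-- `w ↦ -y⁻¹` is a unit of `R[W][1/y]`. [folklore] -/
theorem isUnit_zwToAway_wClass : IsUnit (W.zwToAway (wClass W)) := by
  rw [zwToAway_wClass, IsUnit.neg_iff]
  exact IsUnit.of_mul_eq_one_right _ (Away.mul_invSelf (yClass W))

/-- The transition map `R[W][1/y] → R[W]_O[1/w]` of the two charts (extension of `toZWAway`).
[cite: SilvermanAEC2009, IV.1] -/
def awayYToAwayW : W.AwayY →+* W.AwayW :=
  Away.lift (yClass W) (isUnit_toZWAway_yClass W)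

/-- The transition map `R[W]_O[1/w] → R[W][1/y]` of the two charts (extension of `zwToAway`).
[cite: SilvermanAEC2009, IV.1] -/
def awayWToAwayY : W.AwayW →+* W.AwayY :=
  Away.lift (wClass W) (isUnit_zwToAway_wClass W)

/-- `awayYToAwayW` extends `toZWAway`. [folklore] -/
@[simp]
theorem awayYToAwayW_algebraMap (a : W.toAffine.CoordinateRing) :
    W.awayYToAwayW (algebraMap _ W.AwayY a) = W.toZWAway a :=
  Away.lift_eq _ _ a

/-- `awayWToAwayY` extends `zwToAway`. [folklore] -/
@[simp]
theorem awayWToAwayY_algebraMap (b : W.ZWCoordinateRing) :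
    W.awayWToAwayY (algebraMap _ W.AwayW b) = W.zwToAway b :=
  Away.lift_eq _ _ b

/-- `y⁻¹ ↦ -w`. [folklore] -/
@[simp]
theorem awayYToAwayW_invSelf :
    W.awayYToAwayW (Away.invSelf (yClass W)) = -algebraMap _ W.AwayW (wClass W) := by
  have h1 : W.awayYToAwayW (algebraMap _ W.AwayY (yClass W)) *
      W.awayYToAwayW (Away.invSelf (yClass W)) = 1 := by
    rw [← map_mul, Away.mul_invSelf, map_one]
  rw [awayYToAwayW_algebraMap, toZWAway_yClass] at h1
  refine inv_unique h1 ?_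
  rw [neg_mul_neg, mul_comm, Away.mul_invSelf]

/-- `w⁻¹ ↦ -y`. [folklore] -/
@[simp]
theorem awayWToAwayY_invSelf :
    W.awayWToAwayY (Away.invSelf (wClass W)) = -algebraMap _ W.AwayY (yClass W) := by
  have h1 : W.awayWToAwayY (algebraMap _ W.AwayW (wClass W)) *
      W.awayWToAwayY (Away.invSelf (wClass W)) = 1 := by
    rw [← map_mul, Away.mul_invSelf, map_one]
  rw [awayWToAwayY_algebraMap, zwToAway_wClass] at h1
  refine inv_unique h1 ?_
  rw [neg_mul_neg, mul_comm, Away.mul_invSelf]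

/-- `awayYToAwayW` is `R`-linear. [folklore] -/
@[simp]
theorem awayYToAwayW_algebraMap_base (r : R) :
    W.awayYToAwayW (algebraMap R W.AwayY r) = algebraMap R W.AwayW r := by
  rw [IsScalarTower.algebraMap_apply R W.toAffine.CoordinateRing W.AwayY,
    awayYToAwayW_algebraMap, toZWAway_algebraMap]

/-- `awayWToAwayY` is `R`-linear. [folklore] -/
@[simp]
theorem awayWToAwayY_algebraMap_base (r : R) :
    W.awayWToAwayY (algebraMap R W.AwayW r) = algebraMap R W.AwayY r := by
  rw [IsScalarTower.algebraMap_apply R W.ZWCoordinateRing W.AwayW,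
    awayWToAwayY_algebraMap, zwToAway_algebraMap]

/-- `R[W] → R[W]_O[1/w] → R[W][1/y]` is the localisation map: `z/w ↦ (-x/y)(-y) = x`,
`-1/w ↦ y`. [cite: SilvermanAEC2009, IV.1] -/
theorem awayWToAwayY_comp_toZWAway :
    W.awayWToAwayY.comp W.toZWAway = algebraMap W.toAffine.CoordinateRing W.AwayY := by
  refine Ideal.Quotient.ringHom_ext (Polynomial.ringHom_ext' (Polynomial.ringHom_ext' ?_ ?_) ?_)
  · ext r
    change W.awayWToAwayY (W.toZWAway (algebraMap R _ r)) = algebraMap _ W.AwayY (algebraMap R _ r)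
    rw [toZWAway_algebraMap, awayWToAwayY_algebraMap_base, ← IsScalarTower.algebraMap_apply]
  · change W.awayWToAwayY (W.toZWAway (xClass W)) = algebraMap _ W.AwayY (xClass W)
    have hinv := Away.mul_invSelf (S := W.AwayY) (yClass W)
    rw [toZWAway_xClass, map_mul, awayWToAwayY_algebraMap, zwToAway_zClass, awayWToAwayY_invSelf]
    linear_combination algebraMap _ W.AwayY (xClass W) * hinv
  · change W.awayWToAwayY (W.toZWAway (yClass W)) = algebraMap _ W.AwayY (yClass W)
    rw [toZWAway_yClass, map_neg, awayWToAwayY_invSelf, neg_neg]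

/-- `R[W]_O → R[W][1/y] → R[W]_O[1/w]` is the localisation map: `-x/y ↦ -(z/w)(-w) = z`,
`-1/y ↦ w`. [cite: SilvermanAEC2009, IV.1] -/
theorem awayYToAwayW_comp_zwToAway :
    W.awayYToAwayW.comp W.zwToAway = algebraMap W.ZWCoordinateRing W.AwayW := by
  refine Ideal.Quotient.ringHom_ext (Polynomial.ringHom_ext' (Polynomial.ringHom_ext' ?_ ?_) ?_)
  · ext r
    change W.awayYToAwayW (W.zwToAway (algebraMap R _ r)) = algebraMap _ W.AwayW (algebraMap R _ r)
    rw [zwToAway_algebraMap, awayYToAwayW_algebraMap_base, ← IsScalarTower.algebraMap_apply]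
  · change W.awayYToAwayW (W.zwToAway (wClass W)) = algebraMap _ W.AwayW (wClass W)
    rw [zwToAway_wClass, map_neg, awayYToAwayW_invSelf, neg_neg]
  · change W.awayYToAwayW (W.zwToAway (zClass W)) = algebraMap _ W.AwayW (zClass W)
    have hinv := Away.mul_invSelf (S := W.AwayW) (wClass W)
    rw [zwToAway_zClass, map_neg, map_mul, awayYToAwayW_algebraMap, toZWAway_xClass,
      awayYToAwayW_invSelf]
    linear_combination algebraMap _ W.AwayW (zClass W) * hinv

/-- The two transition maps compose to the identity of `R[W][1/y]`. [cite: SilvermanAEC2009, IV.1] -/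
theorem awayWToAwayY_comp_awayYToAwayW :
    W.awayWToAwayY.comp W.awayYToAwayW = RingHom.id W.AwayY := by
  refine IsLocalization.ringHom_ext (Submonoid.powers (yClass W)) ?_
  rw [RingHom.comp_assoc, awayYToAwayW, Away.lift_comp, RingHom.id_comp]
  exact awayWToAwayY_comp_toZWAway W

/-- The two transition maps compose to the identity of `R[W]_O[1/w]`. [cite: SilvermanAEC2009, IV.1] -/
theorem awayYToAwayW_comp_awayWToAwayY :
    W.awayYToAwayW.comp W.awayWToAwayY = RingHom.id W.AwayW := by
  refine IsLocalization.ringHom_ext (Submonoid.powers (wClass W)) ?_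
  rw [RingHom.comp_assoc, awayWToAwayY, Away.lift_comp, RingHom.id_comp]
  exact awayYToAwayW_comp_zwToAway W

/-- **The two charts of the Weierstrass cubic agree on their overlap**: the transition maps
`z = -x/y`, `w = -1/y` and `x = z/w`, `y = -1/w` are mutually inverse ring isomorphisms
`R[W][1/y] ≅ R[W]_O[1/w]` between the functions on `{y ≠ 0}` in the affine chart and on
`{w ≠ 0}` in the chart at `O` (Silverman, *AEC* IV.1). [cite: SilvermanAEC2009, IV.1] -/
def awayEquiv : W.AwayY ≃+* W.AwayW :=
  RingEquiv.ofRingHom W.awayYToAwayW W.awayWToAwayY (awayYToAwayW_comp_awayWToAwayY W)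
    (awayWToAwayY_comp_awayYToAwayW W)

/-- `awayEquiv` is `awayYToAwayW`. [folklore] -/
@[simp]
theorem awayEquiv_apply (a : W.AwayY) : W.awayEquiv a = W.awayYToAwayW a := rfl

/-- `awayEquiv.symm` is `awayWToAwayY`. [folklore] -/
@[simp]
theorem awayEquiv_symm_apply (b : W.AwayW) : W.awayEquiv.symm b = W.awayWToAwayY b := rfl

/-- The chart transition is `R`-linear. [folklore] -/
theorem awayEquiv_algebraMap_base (r : R) :
    W.awayEquiv (algebraMap R W.AwayY r) = algebraMap R W.AwayW r :=
  awayYToAwayW_algebraMap_base W r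

end Transition

end WeierstrassCurve
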